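import Summits.QuantumFields.BalabanUV.T4Continuum.Support.KroneckerUnits
import Literature.MathematicalPhysics.QuantumFieldTheory.Balaban1983to89.Beta.DeltaACombesThomas

/-!
# T⁴ programme, spine node NE2 (U1a), tier B row B3.a — THE COVARIANT k-FOLD BLOCK AVERAGING `Q_k(R)`:
# Bałaban's vector averaging (1.18) with colour parallel transport along the block contours, as a TYPED operator;
# `Q_k(1) = Q_k ⊗ 1`, and the SIZE LAW `‖√(n^d)·(Q_k(R) − Q_k ⊗ 1)‖ ≤ card o · (e^{(d+1)α} − 1)` from `‖R − 1‖ ≤ α·η` per bond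

NE2 formalisation swarm `b2b-balaban-t4-ne2-formalise-*`, leaf prover 07, row B3.a of `t4/formal/NE2/LEAVES.md` (skeleton
`t4/SKELETON-NE2-P1.md` v0.2 §2B; trigger `t4/T4-NE2-TRIGGER.json`, conditions c1–c6).  The tier-B perturbation of Bałaban's free
operator `Δ_a ⊗ 1` carries the summand `a·(Q_k(U)^*Q_k(U) − Q_k^*Q_k ⊗ 1)` ([Balaban1985BackgroundPropagators] (3.26) p.395
«Δ_a = Δ + DRD* + Q*aQ», (3.16) p.393; `Q_k(U)` = the linear part (3.14)–(3.15) p.393 of the covariant averaging of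
[Balaban1985Averaging], i.e. the block average (1.18) of [Balaban1984PropagatorsI] p.20 «(Q_kA)_b = Σ_{x∈B^k(b₋)} η^{d+1}A([x, x(b)])»
with every fine bond variable PARALLEL-TRANSPORTED to the base point of its block along the contours (1.7) p.18
«Γ_{y,x} = [y,(y₁, …, y_{d−1}, x_d)] ∪ … ∪ [(y₁, x₂, …, x_d), x]» continued by the straight line `[x, x(b)]`).  This file types that
operator and proves the SIZE half of its `PerturbationLaws` input; the two-level (H-cons) half is row B3.b.
DIVERGENCE (D-ne2leaf07-1, XREAD leaf-03 on the render of p.18): the printed contour (1.7) walks the LAST coordinate first; the typed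
`contour` below walks direction `0` first, then `1`, …, `d−1` — the ORDER OF LEGS IS REVERSED w.r.t. (1.7).  Immaterial for every theorem
here and in the companions (the contour system is a PARAMETER `ContourSystem`; only the length bound `≤ (d+1)·n` and the legs/line
decomposition are used, and both orderings satisfy them); v1.1 = this docstring correction only, code byte-identical to v1 (p207814).

* §1 TWO NORM TOOLS (rectangular): `opNorm_le_of_sq_le'` and the RECTANGULAR SCHUR TEST `opNorm_le_sqrt_of_schur`
  (`‖X‖ ≤ √(R·C)` from row sums `≤ R` and column sums `≤ C` of `|X_{ij}|`); `opNorm_QvOp_le : ‖Q_k‖ ≤ n^{−d/2}` (so the free inner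
  averaging `√(n^d)·Q_k ⊗ 1` is a contraction, `opNorm_Bfree_le`).
* §2 TRANSPORT ALONG BOND LISTS: `transport R μ Γ = Π_{b∈Γ} R_{ν(b)}(x(b), μ)` (ordered product, colour slot `μ` = the averaged
  component — for transporters independent of the component slot this is the plain bond product), `transport_append`, and the
  telescoping bound `norm_listProd_sub_one_le : ‖Π − 1‖ ≤ (1 + a)^ℓ − 1` from `‖R_b − 1‖ ≤ a` (no unitarity needed).
* §3 THE CONTOURS (1.7)+(1.18): `leg`, `corner`, `contour y j μ t` (first `j₀` bonds in direction 0, then `j₁` in direction 1, …,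
  then `t` bonds in direction `μ` from `x = n·y + j`), `length_contour_le : |Γ| ≤ (d+1)·n`.  A general CONTOUR SYSTEM
  `Γ : Tor M → (Fin d → Fin n) → Fin d → ℕ → List (bonds)` is allowed as a parameter (Bałaban's (3.15) composes `k` one-step averagings,
  whose composite contours pass through the intermediate block base points; both systems obey the same length bound and the theorems
  below are stated for any system with `|Γ| ≤ ℓ`).
* §4 **`Qcov n M Γ R`** `: Matrix ((Tor M × Fin d) × o) ((Tor (fine n M) × Fin d) × o) ℂ` — entry `((y,μ),α),((x′,μ′),α′)` =
  `[μ′ = μ]·η^{d+1}·Σ_{(j,t): x′ = ny+j+te_μ} transport R μ (Γ y j μ t) α α′` (EVERY pair `(j,t)` reaching `x′` contributes its own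
  contour, exactly as in (1.18) where a fine bond lies on `n` straight lines); **`Qcov_one : Qcov Γ 1 = QvOp ⊗ₖ 1`**; the entry law
  `norm_Qcov_sub_kron_apply_le : ‖(Qcov Γ R − QvOp ⊗ 1)((b,α),(i,α′))‖ ≤ τ·qr b i` (`qr` = the modulus kernel of `Q_k`, tree
  `DeltaACombesThomas.qr`, row sums `1`, column sums `n^{−d}`), hence by §1
  **`opNorm_Qcov_sub_kron_le : ‖Qcov Γ R − QvOp ⊗ₖ 1‖ ≤ card o · τ · (√(n^d))⁻¹`** whenever every contour transporter has `‖T − 1‖ ≤ τ`;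
  and from the PER-BOND size `‖R_ν(i) − 1‖ ≤ α/n` with `|Γ| ≤ (d+1)n`: `τ ≤ (1 + α/n)^{(d+1)n} − 1 ≤ e^{(d+1)α} − 1`
  (**`opNorm_Qcov_sub_kron_le_of_bond`**) — UNIFORM IN THE LEVEL.
* The TOWER PACKAGING (`Bfree`, `Ecov`, `opNorm_Ecov_le`, `gram_eq`) for row B3.b / the owner's Gram law is the companion file
  `Support/CovariantBlockAveragingTower`.

HONEST FRAMING (T4-DAG p. 1).  A TYPED OPERATOR with the printed SHAPE; the transporters `R` are DATA (adjoint transporters of a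
background in the intended reading) — NO assertion of the dictionary B0 (trigger c5), nothing printed is a hypothesis, constants OURS
and symbolic; finite torus, linear layer, operator norm; this is the size half of ONE summand's `PerturbationLaws` — NOT NE2, NOT [B9]
(3.23)–(3.26) as printed (no regions `Λ_j`, no Dirichlet holes), NOT infinite volume / mass gap / Clay; spine 0/9 unchanged.
HONEST DEPENDENCY: continuum YM on T⁴ ⇐ BetaPertH ∧ nine spine estimates (0/9 proved); BetaPertH ⇐ (D1) ∧ (D4) ∧ CAP+tail;
G-an2-4 gates asym, D1 and NE2/3/4.  ABSOLUTE RULE kept; no `sorry`.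
-/

noncomputable section

open scoped BigOperators ComplexConjugate Matrix Matrix.Norms.L2Operator Kronecker

namespace Summit.QuantumFields.BalabanUV.T4Continuum.CovariantBlockAveraging

open Literature.MathematicalPhysics.QuantumFieldTheory.Balaban1983to89.B5Prop11Plancherel (Tor fine unitVec)
open Literature.MathematicalPhysics.QuantumFieldTheory.Balaban1983to89.B5Block118 (QvOp bpt tstep up)
open Literature.MathematicalPhysics.QuantumFieldTheory.Balaban1983to89.B5G183RateOp (norm_sum_mul_sq_le)
open Literature.MathematicalPhysics.QuantumFieldTheory.Balaban1983to89.B5G183RateUnitTower (lev lev_neZero)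
open Literature.MathematicalPhysics.QuantumFieldTheory.Balaban1983to89.Beta.DeltaACombesThomas (qr qr_nonneg norm_QvOp_le
  sum_qr_row sum_qr_col)
open Summit.QuantumFields.BalabanUV.T4Continuum.BalabanAveragedTowerUnit (idx norm_entry_le_opNorm one_le_lev' cast_lev')
open Summit.QuantumFields.BalabanUV.T4Continuum.KroneckerLift
open Summit.QuantumFields.BalabanUV.T4Continuum.BlockMultiplication
open Summit.QuantumFields.BalabanUV.T4Continuum.KroneckerUnits

/-! ## §1 Rectangular norm tools -/

section Schur

variable {β γ : Type*} [Fintype β] [Fintype γ] [DecidableEq γ]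

/-- operator-norm bound from a quadratic bound on coordinates, RECTANGULAR version of the tree's `opNorm_le_of_sq_le`:
if `Σ_i |Σ_j X_ij x_j|² ≤ C² Σ_j |x_j|²` for all `x` then `‖X‖ ≤ C`. [folklore] -/
theorem opNorm_le_of_sq_le' (X : Matrix β γ ℂ) {C : ℝ} (hC : 0 ≤ C)
    (h : ∀ x : γ → ℂ, ∑ i, ‖∑ j, X i j * x j‖ ^ 2 ≤ C ^ 2 * ∑ j, ‖x j‖ ^ 2) : ‖X‖ ≤ C := by
  rw [Matrix.l2_opNorm_def]
  refine ContinuousLinearMap.opNorm_le_bound _ hC fun ψ => ?_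
  have h1 : ‖((Matrix.toEuclideanLin (𝕜 := ℂ) (m := β) (n := γ)).trans LinearMap.toContinuousLinearMap X) ψ‖ ^ 2
      = ∑ i, ‖∑ j, X i j * ψ j‖ ^ 2 := by
    rw [EuclideanSpace.norm_sq_eq]
    rfl
  have h2 : ‖ψ‖ ^ 2 = ∑ j, ‖ψ j‖ ^ 2 := EuclideanSpace.norm_sq_eq ψ
  have h3 := h (fun j => ψ j)
  rw [← h1, ← h2, ← mul_pow] at h3
  exact (pow_le_pow_iff_left₀ (norm_nonneg _) (mul_nonneg hC (norm_nonneg _)) two_ne_zero).mp h3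

/-- **RECTANGULAR SCHUR TEST**: if the row sums of `|X_ij|` are `≤ R` and the column sums `≤ C`, then `‖X‖ ≤ √(R·C)`. [folklore] -/
theorem opNorm_le_sqrt_of_schur (X : Matrix β γ ℂ) {R C : ℝ} (hR0 : 0 ≤ R) (hC0 : 0 ≤ C)
    (hr : ∀ i, ∑ j, ‖X i j‖ ≤ R) (hc : ∀ j, ∑ i, ‖X i j‖ ≤ C) : ‖X‖ ≤ Real.sqrt (R * C) := by
  refine opNorm_le_of_sq_le' X (Real.sqrt_nonneg _) fun x => ?_
  rw [Real.sq_sqrt (mul_nonneg hR0 hC0)]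
  have hw : ∀ i, 0 ≤ ∑ j, ‖X i j‖ * ‖x j‖ ^ 2 := fun i =>
    Finset.sum_nonneg fun j _ => mul_nonneg (norm_nonneg _) (sq_nonneg _)
  calc ∑ i, ‖∑ j, X i j * x j‖ ^ 2
      ≤ ∑ i, R * ∑ j, ‖X i j‖ * ‖x j‖ ^ 2 :=
        Finset.sum_le_sum fun i _ => (norm_sum_mul_sq_le _ _).trans (mul_le_mul_of_nonneg_right (hr i) (hw i))
    _ = R * ∑ j, (∑ i, ‖X i j‖) * ‖x j‖ ^ 2 := by
        rw [← Finset.mul_sum, Finset.sum_comm]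
        congr 1
        refine Finset.sum_congr rfl fun j _ => ?_
        rw [Finset.sum_mul]
    _ ≤ R * ∑ j, C * ‖x j‖ ^ 2 :=
        mul_le_mul_of_nonneg_left (Finset.sum_le_sum fun j _ => mul_le_mul_of_nonneg_right (hc j) (sq_nonneg _)) hR0
    _ = R * C * ∑ j, ‖x j‖ ^ 2 := by rw [← Finset.mul_sum, mul_assoc]

end Schur

/-! ## §2 Transport along bond lists -/

section Transport

variable {o : Type*} [Fintype o] [DecidableEq o]

/-- **TELESCOPING**: if every factor is within `a` of the identity, a product of `ℓ` factors is within `(1 + a)^ℓ − 1` of the identity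
(`XY − 1 = (X − 1)(Y − 1) + (X − 1) + (Y − 1)`; no unitarity assumed). [folklore] -/
theorem norm_listProd_sub_one_le (l : List (Matrix o o ℂ)) {a : ℝ} (ha : 0 ≤ a) (h : ∀ X ∈ l, ‖X - 1‖ ≤ a) :
    ‖l.prod - 1‖ ≤ (1 + a) ^ l.length - 1 := by
  induction l with
  | nil => simp
  | cons X l ih =>
    have hX : ‖X - 1‖ ≤ a := h X (List.mem_cons_self)
    have hl : ‖l.prod - 1‖ ≤ (1 + a) ^ l.length - 1 := ih fun Y hY => h Y (List.mem_cons_of_mem X hY)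
    have hP : 0 ≤ (1 + a) ^ l.length - 1 := sub_nonneg.mpr (one_le_pow₀ (by linarith))
    have e : (X :: l).prod - 1 = (X - 1) * (l.prod - 1) + (X - 1) + (l.prod - 1) := by
      rw [List.prod_cons]; noncomm_ring
    rw [e, List.length_cons, pow_succ]
    calc ‖(X - 1) * (l.prod - 1) + (X - 1) + (l.prod - 1)‖
        ≤ ‖X - 1‖ * ‖l.prod - 1‖ + ‖X - 1‖ + ‖l.prod - 1‖ :=
          (norm_add_le _ _).trans (add_le_add ((norm_add_le _ _).trans (add_le_add (Matrix.l2_opNorm_mul _ _) le_rfl)) le_rfl)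
      _ ≤ a * ((1 + a) ^ l.length - 1) + a + ((1 + a) ^ l.length - 1) :=
          add_le_add (add_le_add (mul_le_mul hX hl (norm_nonneg _) ha) hX) hl
      _ = (1 + a) ^ l.length * (1 + a) - 1 := by ring

/-- `(1 + a)^ℓ − 1` is monotone in `ℓ`. [folklore] -/
theorem pow_sub_one_mono {a : ℝ} (ha : 0 ≤ a) {ℓ ℓ' : ℕ} (h : ℓ ≤ ℓ') : (1 + a) ^ ℓ - 1 ≤ (1 + a) ^ ℓ' - 1 :=
  sub_le_sub_right (pow_le_pow_right₀ (by linarith) h) 1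

/-- `(1 + α/n)^{m·n} − 1 ≤ e^{m·α} − 1`. [folklore] -/
theorem pow_sub_one_le_exp {α : ℝ} (hα : 0 ≤ α) (m n : ℕ) (hn : 0 < n) :
    (1 + α / n) ^ (m * n) - 1 ≤ Real.exp (m * α) - 1 := by
  refine sub_le_sub_right ?_ 1
  have hn' : (0 : ℝ) < n := by exact_mod_cast hn
  have h1 : (1 + α / n) ≤ Real.exp (α / n) := by
    have := Real.add_one_le_exp (α / n); linarith
  calc (1 + α / n) ^ (m * n) ≤ Real.exp (α / n) ^ (m * n) :=
        pow_le_pow_left₀ (by positivity) h1 _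
    _ = Real.exp (m * α) := by
        rw [← Real.exp_nat_mul]; congr 1; push_cast; field_simp

variable {d : ℕ} (Nf : Fin d → ℕ) [hNf : ∀ μ, NeZero (Nf μ)]

/-- **PARALLEL TRANSPORT ALONG A BOND LIST** read in colour slot `μ`: `Π_{(x,ν)∈Γ} R_ν(x, μ)` (ordered, first bond leftmost —
«U(Γ) = Π_i U(x_i, x_{i+1})» [Balaban1985Averaging] (9) p.18, shape). [folklore] -/
def transport (R : Fin d → (Tor Nf × Fin d → Matrix o o ℂ)) (μ : Fin d) (Γ : List (Tor Nf × Fin d)) : Matrix o o ℂ :=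
  (Γ.map fun b => R b.2 (b.1, μ)).prod

omit hNf in
/-- concatenated contours multiply. [folklore] -/
theorem transport_append (R : Fin d → (Tor Nf × Fin d → Matrix o o ℂ)) (μ : Fin d) (Γ Γ' : List (Tor Nf × Fin d)) :
    transport Nf R μ (Γ ++ Γ') = transport Nf R μ Γ * transport Nf R μ Γ' := by
  rw [transport, transport, transport, List.map_append, List.prod_append]

omit hNf in
/-- trivial transporters transport trivially. [folklore] -/
theorem transport_one (μ : Fin d) (Γ : List (Tor Nf × Fin d)) :
    transport Nf (fun _ _ => (1 : Matrix o o ℂ)) μ Γ = 1 := by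
  rw [transport]
  induction Γ with
  | nil => simp
  | cons b Γ ih => rw [List.map_cons, List.prod_cons, ih, Matrix.one_mul]

omit hNf in
/-- the transporter of a contour of length `≤ ℓ` with `‖R − 1‖ ≤ a` per bond is within `(1 + a)^ℓ − 1` of the identity. [folklore] -/
theorem norm_transport_sub_one_le {R : Fin d → (Tor Nf × Fin d → Matrix o o ℂ)} {a : ℝ} (ha : 0 ≤ a)
    (hR : ∀ ν i, ‖R ν i - 1‖ ≤ a) (μ : Fin d) {Γ : List (Tor Nf × Fin d)} {ℓ : ℕ} (hΓ : Γ.length ≤ ℓ) :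
    ‖transport Nf R μ Γ - 1‖ ≤ (1 + a) ^ ℓ - 1 := by
  have h := norm_listProd_sub_one_le (Γ.map fun b => R b.2 (b.1, μ)) ha (fun X hX => by
    obtain ⟨b, _, rfl⟩ := List.mem_map.mp hX
    exact hR _ _)
  rw [List.length_map] at h
  exact h.trans (pow_sub_one_mono ha hΓ)

end Transport

/-! ## §3 The contours (1.7) + (1.18) -/

section Contour

variable {d : ℕ} (n : ℕ) [NeZero n] (M : Fin d → ℕ) [hM : ∀ μ, NeZero (M μ)]

/-- the straight leg of `s` bonds in direction `ν` starting at `z`: `⟨z, z+e_ν⟩, …, ⟨z+(s−1)e_ν, z+se_ν⟩`. [folklore] -/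
def leg (ν : Fin d) (z : Tor (fine n M)) (s : ℕ) : List (Tor (fine n M) × Fin d) :=
  (List.range s).map fun r => (z + tstep (fine n M) ν r, ν)

omit [NeZero n] hM in
/-- a leg of `s` bonds has length `s`. [folklore] -/
@[simp] theorem length_leg (ν : Fin d) (z : Tor (fine n M)) (s : ℕ) : (leg n M ν z s).length = s := by
  rw [leg, List.length_map, List.length_range]

/-- the corner of the contour (1.7) after the first `m` directions have been walked: `n·y + (j₀, …, j_{m−1}, 0, …, 0)`.
[cite: Balaban1984PropagatorsI, (1.7) p.18 (shape)] [folklore] -/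
def corner (y : Tor M) (j : Fin d → Fin n) (m : ℕ) : Tor (fine n M) :=
  up n M y + fun ν : Fin d => if (ν : ℕ) < m then ((j ν : ℕ) : ZMod (fine n M ν)) else 0

/-- **THE CONTOUR** `Γ_{y,x} ∪ [x, x + t·ηe_μ]`, `x = n·y + j`: `j₀` bonds in direction `0` from `n·y`, then `j₁` bonds in direction `1`,
…, then `t` bonds in direction `μ` from `x` (printed (1.7): «Γ_{y,x} = [y,(y₁, …, y_{d−1}, x_d)] ∪ … ∪ [(y₁, x₂, …, x_d), x]» — the
paper walks the LAST coordinate first, this definition the FIRST: leg order reversed, DIVERGENCE D-ne2leaf07-1; the line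
«A([x, x(b)])» of (1.18)). [cite: Balaban1984PropagatorsI, (1.7) p.18, (1.18) p.20 (shape)] [folklore] -/
def contour (y : Tor M) (j : Fin d → Fin n) (μ : Fin d) (t : ℕ) : List (Tor (fine n M) × Fin d) :=
  ((List.finRange d).flatMap fun ν : Fin d => leg n M ν (corner n M y j (ν : ℕ)) (j ν : ℕ)) ++ leg n M μ (bpt n M y j) t

omit [NeZero n] hM in
/-- the contour to a bond of the block has at most `(d+1)·n` bonds (`j_ν < n`, `t < n`). [folklore] -/
theorem length_contour_le (y : Tor M) (j : Fin d → Fin n) (μ : Fin d) {t : ℕ} (ht : t < n) :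
    (contour n M y j μ t).length ≤ (d + 1) * n := by
  rw [contour, List.length_append, List.length_flatMap, length_leg]
  have h1 : (List.map (fun ν : Fin d => (leg n M ν (corner n M y j (ν : ℕ)) (j ν : ℕ)).length) (List.finRange d)).sum ≤ d * n := by
    have h2 : ∀ x ∈ List.map (fun ν : Fin d => (leg n M ν (corner n M y j (ν : ℕ)) (j ν : ℕ)).length) (List.finRange d), x ≤ n := by
      intro x hx
      obtain ⟨ν, _, rfl⟩ := List.mem_map.mp hx
      rw [length_leg]; exact (j ν).is_lt.le
    have h3 := List.sum_le_card_nsmul _ n h2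
    rw [List.length_map, List.length_finRange, smul_eq_mul] at h3
    exact h3
  calc _ ≤ d * n + n := add_le_add h1 ht.le
    _ = (d + 1) * n := by ring

end Contour

/-! ## §4 The covariant block averaging -/

section OneLevel

variable {d : ℕ} (n : ℕ) [NeZero n] (M : Fin d → ℕ) [hM : ∀ μ, NeZero (M μ)] {o : Type*} [Fintype o] [DecidableEq o]

/-- a CONTOUR SYSTEM: for every unit-lattice base point `y`, block offset `j`, direction `μ` and line position `t`, the bond list along
which the fine bond `⟨ny+j+te_μ, · + e_μ⟩` is transported to `y` (canonical instance: `contour n M`). [folklore] -/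
abbrev ContourSystem (d n : ℕ) (M : Fin d → ℕ) := Tor M → (Fin d → Fin n) → Fin d → ℕ → List (Tor (fine n M) × Fin d)

/-- **THE COVARIANT k-FOLD BLOCK AVERAGING** `Q_k(R)` on colour-valued vector fields: Bałaban's (1.18) with each fine bond variable
transported to the base point of its block along the contour system `Γ` —
`(Q_k(R)A)_μ(y) = η^{d+1} Σ_{j∈{0..n−1}^d} Σ_{t<n} T(Γ_{y,j,μ,t})·A_μ(ny + j + te_μ)`, `T = transport R μ`.
[cite: Balaban1985BackgroundPropagators, (3.14)–(3.15) p.393; Balaban1984PropagatorsI, (1.18) p.20 (shape)] [folklore] -/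
def Qcov (Γ : ContourSystem d n M) (R : Fin d → (Tor (fine n M) × Fin d → Matrix o o ℂ)) :
    Matrix ((Tor M × Fin d) × o) ((Tor (fine n M) × Fin d) × o) ℂ :=
  fun b i => if i.1.2 = b.1.2 then
      ∑ j : Fin d → Fin n, ∑ t : Fin n,
        (if i.1.1 = bpt n M b.1.1 j + tstep (fine n M) b.1.2 t then
          (1 / (n : ℂ) ^ (d + 1)) * transport (fine n M) R b.1.2 (Γ b.1.1 j b.1.2 t) b.2 i.2 else 0)
    else 0

omit [NeZero n] hM in
/-- **AT `R = 1` THE COVARIANT AVERAGING IS `Q_k ⊗ 1`** (by construction, for every contour system). [folklore] -/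
theorem Qcov_one (Γ : ContourSystem d n M) :
    Qcov n M Γ (fun _ _ => (1 : Matrix o o ℂ)) = QvOp n M ⊗ₖ (1 : Matrix o o ℂ) := by
  ext ⟨b, α⟩ ⟨i, α'⟩
  simp only [Qcov, transport_one, Matrix.kroneckerMap_apply, QvOp]
  by_cases h : i.2 = b.2
  · rw [if_pos h, if_pos h, Finset.sum_mul]
    refine Finset.sum_congr rfl fun j _ => ?_
    rw [Finset.sum_mul]
    refine Finset.sum_congr rfl fun t _ => ?_
    split_ifs <;> simp
  · rw [if_neg h, if_neg h, zero_mul]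

omit [NeZero n] hM in
/-- the entries of the TRANSPORT ERROR `Q_k(R) − Q_k ⊗ 1`. [folklore] -/
theorem Qcov_sub_kron_apply (Γ : ContourSystem d n M) (R : Fin d → (Tor (fine n M) × Fin d → Matrix o o ℂ))
    (b : (Tor M × Fin d) × o) (i : (Tor (fine n M) × Fin d) × o) :
    (Qcov n M Γ R - QvOp n M ⊗ₖ (1 : Matrix o o ℂ)) b i
      = if i.1.2 = b.1.2 then
          ∑ j : Fin d → Fin n, ∑ t : Fin n,
            (if i.1.1 = bpt n M b.1.1 j + tstep (fine n M) b.1.2 t then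
              (1 / (n : ℂ) ^ (d + 1)) * (transport (fine n M) R b.1.2 (Γ b.1.1 j b.1.2 t) - 1) b.2 i.2 else 0)
        else 0 := by
  rw [← Qcov_one n M Γ, Matrix.sub_apply]
  simp only [Qcov, transport_one]
  by_cases h : i.1.2 = b.1.2
  · rw [if_pos h, if_pos h, if_pos h, ← Finset.sum_sub_distrib]
    refine Finset.sum_congr rfl fun j _ => ?_
    rw [← Finset.sum_sub_distrib]
    refine Finset.sum_congr rfl fun t _ => ?_
    split_ifs
    · rw [Matrix.sub_apply, mul_sub]
    · rw [sub_zero]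
  · rw [if_neg h, if_neg h, if_neg h, sub_zero]

omit [NeZero n] hM in
/-- **ENTRY LAW**: if every contour transporter is within `τ` of the identity, the `((b,α),(i,α′))` entry of the transport error is at most
`τ·qr(b, i)` (`qr` = the modulus kernel of `Q_k`, (1.18)). [folklore] -/
theorem norm_Qcov_sub_kron_apply_le (Γ : ContourSystem d n M) {R : Fin d → (Tor (fine n M) × Fin d → Matrix o o ℂ)} {τ : ℝ}
    (hτ : 0 ≤ τ) (hT : ∀ y j μ (t : Fin n), ‖transport (fine n M) R μ (Γ y j μ t) - 1‖ ≤ τ)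
    (b : (Tor M × Fin d) × o) (i : (Tor (fine n M) × Fin d) × o) :
    ‖(Qcov n M Γ R - QvOp n M ⊗ₖ (1 : Matrix o o ℂ)) b i‖ ≤ τ * qr n M b.1 i.1 := by
  rw [Qcov_sub_kron_apply]
  by_cases h : i.1.2 = b.1.2
  · rw [if_pos h]
    have hqr : qr n M b.1 i.1 = ∑ j : Fin d → Fin n, ∑ t : Fin n,
        (if i.1.1 = bpt n M b.1.1 j + tstep (fine n M) b.1.2 t then 1 / (n : ℝ) ^ (d + 1) else 0) := by
      rw [qr]
      refine Finset.sum_congr rfl fun j _ => Finset.sum_congr rfl fun t _ => ?_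
      have hiff : i.1 = (bpt n M b.1.1 j + tstep (fine n M) b.1.2 t, b.1.2) ↔ i.1.1 = bpt n M b.1.1 j + tstep (fine n M) b.1.2 t :=
        ⟨fun hi => by rw [hi], fun hi => Prod.ext hi h⟩
      by_cases hc : i.1.1 = bpt n M b.1.1 j + tstep (fine n M) b.1.2 t
      · rw [if_pos hc, if_pos (hiff.mpr hc)]
      · rw [if_neg hc, if_neg (fun h' => hc (hiff.mp h'))]
    rw [hqr, Finset.mul_sum]
    refine (norm_sum_le _ _).trans (Finset.sum_le_sum fun j _ => ?_)
    rw [Finset.mul_sum]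
    refine (norm_sum_le _ _).trans (Finset.sum_le_sum fun t _ => ?_)
    split_ifs
    · rw [norm_mul, norm_div, norm_one, norm_pow, Complex.norm_natCast, mul_comm]
      exact mul_le_mul_of_nonneg_right ((norm_entry_le_opNorm _ _ _).trans (hT _ _ _ _)) (by positivity)
    · simp
  · rw [if_neg h, norm_zero]
    exact mul_nonneg hτ (qr_nonneg n M b.1 i.1)

/-- **THE SIZE LAW (operator norm)**: `‖Q_k(R) − Q_k ⊗ 1‖ ≤ card o · τ · (√(n^d))⁻¹` — rectangular Schur test with the row sums `1`
and column sums `n^{−d}` of `qr`. [folklore] -/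
theorem opNorm_Qcov_sub_kron_le (Γ : ContourSystem d n M) {R : Fin d → (Tor (fine n M) × Fin d → Matrix o o ℂ)} {τ : ℝ}
    (hτ : 0 ≤ τ) (hT : ∀ y j μ (t : Fin n), ‖transport (fine n M) R μ (Γ y j μ t) - 1‖ ≤ τ) :
    ‖Qcov n M Γ R - QvOp n M ⊗ₖ (1 : Matrix o o ℂ)‖ ≤ Fintype.card o * τ * (Real.sqrt ((n : ℝ) ^ d))⁻¹ := by
  have hn : (0 : ℝ) < (n : ℝ) ^ d := pow_pos (by exact_mod_cast Nat.pos_of_ne_zero (NeZero.ne n)) d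
  have hco : (0 : ℝ) ≤ Fintype.card o := Nat.cast_nonneg _
  have hrow : ∀ b : (Tor M × Fin d) × o, ∑ i : (Tor (fine n M) × Fin d) × o,
      ‖(Qcov n M Γ R - QvOp n M ⊗ₖ (1 : Matrix o o ℂ)) b i‖ ≤ Fintype.card o * τ := by
    intro b
    calc _ ≤ ∑ i : (Tor (fine n M) × Fin d) × o, τ * qr n M b.1 i.1 :=
          Finset.sum_le_sum fun i _ => norm_Qcov_sub_kron_apply_le n M Γ hτ hT b i
      _ = Fintype.card o * τ := by
          rw [Fintype.sum_prod_type, Finset.sum_comm]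
          simp only [Finset.sum_const, Finset.card_univ, nsmul_eq_mul, ← Finset.mul_sum]
          rw [sum_qr_row, mul_one]
  have hcol : ∀ i : (Tor (fine n M) × Fin d) × o, ∑ b : (Tor M × Fin d) × o,
      ‖(Qcov n M Γ R - QvOp n M ⊗ₖ (1 : Matrix o o ℂ)) b i‖ ≤ Fintype.card o * τ * (1 / (n : ℝ) ^ d) := by
    intro i
    calc _ ≤ ∑ b : (Tor M × Fin d) × o, τ * qr n M b.1 i.1 :=
          Finset.sum_le_sum fun b _ => norm_Qcov_sub_kron_apply_le n M Γ hτ hT b i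
      _ = Fintype.card o * τ * (1 / (n : ℝ) ^ d) := by
          rw [Fintype.sum_prod_type, Finset.sum_comm]
          simp only [Finset.sum_const, Finset.card_univ, nsmul_eq_mul, ← Finset.mul_sum]
          rw [sum_qr_col, mul_assoc]
  refine (opNorm_le_sqrt_of_schur _ (by positivity) (by positivity) hrow hcol).trans (le_of_eq ?_)
  rw [show (Fintype.card o : ℝ) * τ * (Fintype.card o * τ * (1 / (n : ℝ) ^ d)) = (Fintype.card o * τ) ^ 2 * ((n : ℝ) ^ d)⁻¹ by ring,
    Real.sqrt_mul (sq_nonneg _), Real.sqrt_sq (by positivity), Real.sqrt_inv]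

/-- **THE SIZE LAW FROM THE PER-BOND SIZE**, for the canonical contours: if `‖R_ν(i) − 1‖ ≤ α/n` for every bond then
`‖Q_k(R) − Q_k ⊗ 1‖ ≤ card o · (e^{(d+1)α} − 1) · (√(n^d))⁻¹` — uniform in the level. [folklore] -/
theorem opNorm_Qcov_sub_kron_le_of_bond {R : Fin d → (Tor (fine n M) × Fin d → Matrix o o ℂ)} {α : ℝ} (hα : 0 ≤ α)
    (hR : ∀ ν i, ‖R ν i - 1‖ ≤ α / n) :
    ‖Qcov n M (contour n M) R - QvOp n M ⊗ₖ (1 : Matrix o o ℂ)‖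
      ≤ Fintype.card o * (Real.exp ((d + 1 : ℕ) * α) - 1) * (Real.sqrt ((n : ℝ) ^ d))⁻¹ := by
  have hn : 0 < n := Nat.pos_of_ne_zero (NeZero.ne n)
  have ha : 0 ≤ α / n := by positivity
  have hexp : 0 ≤ Real.exp ((d + 1 : ℕ) * α) - 1 := sub_nonneg.mpr (Real.one_le_exp (by positivity))
  refine opNorm_Qcov_sub_kron_le n M (contour n M) hexp fun y j μ t => ?_
  exact (norm_transport_sub_one_le (fine n M) ha hR μ (length_contour_le n M y j μ t.is_lt)).trans
    (pow_sub_one_le_exp hα (d + 1) n hn)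

/-- **`‖Q_k‖ ≤ n^{−d/2}`** for Bałaban's vector averaging (1.18) (Schur: row sums `1`, column sums `n^{−d}`).
[cite: Balaban1984PropagatorsI, (1.18) p.20] [folklore] -/
theorem opNorm_QvOp_le : ‖QvOp n M‖ ≤ (Real.sqrt ((n : ℝ) ^ d))⁻¹ := by
  have hn : (0 : ℝ) < (n : ℝ) ^ d := pow_pos (by exact_mod_cast Nat.pos_of_ne_zero (NeZero.ne n)) d
  have hrow : ∀ b : Tor M × Fin d, ∑ i, ‖QvOp n M b i‖ ≤ 1 := fun b =>
    (Finset.sum_le_sum fun i _ => norm_QvOp_le n M b i).trans (sum_qr_row n M b).le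
  have hcol : ∀ i : Tor (fine n M) × Fin d, ∑ b, ‖QvOp n M b i‖ ≤ 1 / (n : ℝ) ^ d := fun i =>
    (Finset.sum_le_sum fun b _ => norm_QvOp_le n M b i).trans (sum_qr_col n M i).le
  refine (opNorm_le_sqrt_of_schur _ zero_le_one (by positivity) hrow hcol).trans (le_of_eq ?_)
  rw [one_mul, one_div, Real.sqrt_inv]

end OneLevel

end Summit.QuantumFields.BalabanUV.T4Continuum.CovariantBlockAveraging

end
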